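import Mathlib
import HarnessLib
import Literature.MathematicalPhysics.StatisticalMechanics.LennardJonesClusters
import Summits.AtomisticToContinuum.Crystallization.Theorems.ContactSaturationLadderCrossTermFloor
import Summits.AtomisticToContinuum.Crystallization.Theorems.ContactSaturationLadderWindowFloor

/-!
# ContactSaturationLadder · `LooseTextureRung` (stmt-AtomisticToContinuum-30303) · helper — the CROSS-TERM CEILING and the
window ↔ chunk CURRENCY EXCHANGE (decomp-a2c · lens-1 · gen 17; concordance #6 (ii), CRITIC-LEDGER row 123)

The tree already has the cross-term FLOOR (`ContactSaturationLadderCrossTermFloor.stub_crossTermFloor`, p775283): for a Lennard-Jones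
ground state and `ρ ≥ 9`, `−C₂ρ² ≤ ½ Σ_{i ∈ B(p,ρ)} Σ_{k ∉ B(p,ρ)} V_LJ(|y_i − y_k|)`.  This file supplies the other half and the exchange:

* `crossCeiling_of_sep` (GROUND-STATE-FREE): for every `δ`-separated configuration (`0 < δ ≤ 1`) and `ρ ≥ 2`,
  `½ Σ_{i ∈ B(p,ρ)} Σ_{k ∉ B(p,ρ)} V_LJ ≤ C(δ)·ρ²` with the explicit `C(δ) = crossCeilingConst δ = (9/2)·δ⁻¹⁵·(2δ⁻¹+1)³`.
  Mechanism: `V_LJ ≤ 0` beyond distance `1` (`lennardJones_nonpos`), so only the unit shell `ρ−1 < |y_i − p| ≤ ρ`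
  (`≤ 48δ⁻³(ρ+1)²` sites, `layer_card`) meets the outside repulsively, each site with `≤ (2δ⁻¹+1)³` partners within distance `1`
  (`core_card`), each contact `≤ (1/12)δ⁻¹²`.
* `crossCeiling` (ground states, `ρ ≥ 9`, via `LennardJonesMinimalDistance_holds`) and the two-sided `crossTerm_abs_le`.
* `window_split` / `window_chunk_exchange`: `Σ_{i∈W}(½𝓔ⁱ − e) = (½ Σ_{i∈W} Σ_{k∈W∖i} V − #W·e) + ½ Σ_{i∈W} Σ_{k∉W} V`, hence for ground
  states the WINDOW currency (site energies, lens-1 `FarGapFree`/`NearGapEvFree`/`BulkGapCertificate`) and the CHUNK currency (internal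
  energy of the ball cluster, lens-1 `ThinClusterFloor`/`ChunkGap`, lens-5 `ExcessAt`) differ by at most `C·ρ²` in BOTH directions.

No new definitions besides the constant `crossCeilingConst`; statements are in the raw-sum shape of the CrossTermFloor file.
-/

noncomputable section

namespace Summit.AtomisticToContinuum.Crystallization.Theorems.ContactSaturationLadderCrossCeiling

open scoped BigOperators Classical
open Metric
open Literature.MathematicalPhysics.StatisticalMechanics (lennardJones IsGroundState siteEnergy LennardJonesMinimalDistance_holds
  lennardJones_nonpos PeriodicConfiguration)
open Summit.AtomisticToContinuum.Crystallization.Theorems.ContactSaturationLadderCrossTermFloor (layer_card core_card stub_crossTermFloor)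
open Summit.AtomisticToContinuum.Crystallization.Theorems.ContactSaturationLadderWindowFloor (siteEnergy_split card_mul_iInf_le_half_sum)

variable {N : ℕ}

/-! ## §1 Pointwise bounds on the potential -/

/-- Above a hard core `δ > 0` the Lennard-Jones potential is at most `(1/12)·δ⁻¹²`. -/
theorem lennardJones_le_of_le {δ r : ℝ} (hδ : 0 < δ) (h : δ ≤ r) : lennardJones r ≤ (1 / 12) * δ⁻¹ ^ 12 := by
  have hr : 0 < r := lt_of_lt_of_le hδ h
  have h1 : r⁻¹ ≤ δ⁻¹ := by rw [inv_le_inv₀ hr hδ]; exact h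
  have h0 : 0 ≤ r⁻¹ := inv_nonneg.2 hr.le
  have h2 : r⁻¹ ^ 12 ≤ δ⁻¹ ^ 12 := pow_le_pow_left₀ h0 h1 12
  have h3 : 0 ≤ r⁻¹ ^ 6 := pow_nonneg h0 6
  unfold Literature.MathematicalPhysics.StatisticalMechanics.lennardJones
  nlinarith

/-! ## §2 Per-site cross bounds -/

/-- A site at depth `≥ 1` below the sphere interacts with the outside only attractively: its cross sum is `≤ 0`. -/
theorem cross_site_nonpos (y : Fin N → EuclideanSpace ℝ (Fin 3)) (p : EuclideanSpace ℝ (Fin 3)) (ρ : ℝ)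
    (T : Finset (Fin N)) (hT : ∀ k ∈ T, ρ < dist (y k) p) {i : Fin N} (hi : dist (y i) p ≤ ρ - 1) :
    ∑ k ∈ T, lennardJones (dist (y i) (y k)) ≤ 0 := by
  refine Finset.sum_nonpos fun k hk => lennardJones_nonpos ?_
  have hkp := hT k hk
  have ht := dist_triangle (y k) (y i) p
  rw [dist_comm (y k) (y i)] at ht
  linarith

/-- Any site of a `δ`-separated configuration interacts with any set of OTHER sites by at most `(2δ⁻¹+1)³·(1/12)δ⁻¹²`
(only partners within distance `1` contribute positively, and there are at most `(2δ⁻¹+1)³` of them). -/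
theorem cross_site_le (y : Fin N → EuclideanSpace ℝ (Fin 3)) {δ : ℝ} (hδ : 0 < δ)
    (hsep : ∀ k l : Fin N, k ≠ l → δ ≤ dist (y k) (y l)) (T : Finset (Fin N)) {i : Fin N}
    (hTi : ∀ k ∈ T, k ≠ i) :
    ∑ k ∈ T, lennardJones (dist (y i) (y k)) ≤ (2 * 1 / δ + 1) ^ 3 * ((1 / 12) * δ⁻¹ ^ 12) := by
  have hyinj : Function.Injective y := by
    intro k l hkl
    by_contra h
    have := hsep k l h
    rw [hkl, dist_self] at this
    linarith
  rw [← Finset.sum_filter_add_sum_filter_not T (fun k : Fin N => dist (y k) (y i) ≤ 1)]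
  have hfar : ∑ k ∈ T.filter (fun k => ¬ dist (y k) (y i) ≤ 1), lennardJones (dist (y i) (y k)) ≤ 0 := by
    refine Finset.sum_nonpos fun k hk => lennardJones_nonpos ?_
    have h := (Finset.mem_filter.1 hk).2
    rw [dist_comm] at h
    linarith [not_le.1 h]
  have hnear : ∑ k ∈ T.filter (fun k => dist (y k) (y i) ≤ 1), lennardJones (dist (y i) (y k))
      ≤ ((T.filter (fun k => dist (y k) (y i) ≤ 1)).card : ℝ) * ((1 / 12) * δ⁻¹ ^ 12) := by
    have h1 : ∀ k ∈ T.filter (fun k => dist (y k) (y i) ≤ 1), lennardJones (dist (y i) (y k)) ≤ (1 / 12) * δ⁻¹ ^ 12 := by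
      intro k hk
      have hk' := (Finset.mem_filter.1 hk).1
      exact lennardJones_le_of_le hδ (hsep i k (hTi k hk').symm)
    have h2 := Finset.sum_le_sum h1
    rw [Finset.sum_const, nsmul_eq_mul] at h2
    exact h2
  have hcard : ((T.filter (fun k => dist (y k) (y i) ≤ 1)).card : ℝ) ≤ (2 * 1 / δ + 1) ^ 3 := by
    have hsub : T.filter (fun k => dist (y k) (y i) ≤ 1) ⊆ Finset.univ.filter (fun k : Fin N => dist (y k) (y i) ≤ 1) := by
      intro k hk
      simp only [Finset.mem_filter, Finset.mem_univ, true_and]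
      exact (Finset.mem_filter.1 hk).2
    have h := core_card y hyinj hδ hsep (y i) (R := 1) zero_le_one
    exact le_trans (by exact_mod_cast Finset.card_le_card hsub) h
  have hV0 : 0 ≤ (1 / 12) * δ⁻¹ ^ 12 := by positivity
  have h3 := mul_le_mul_of_nonneg_right hcard hV0
  linarith

/-! ## §3 The cross-term CEILING, ground-state-free -/

/-- The explicit ceiling constant `C(δ) = (9/2)·δ⁻¹⁵·(2δ⁻¹+1)³`. -/
def crossCeilingConst (δ : ℝ) : ℝ := (9 / 2) * δ⁻¹ ^ 15 * (2 * 1 / δ + 1) ^ 3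

/-- The ceiling constant is non-negative. -/
theorem crossCeilingConst_nonneg {δ : ℝ} (hδ : 0 < δ) : 0 ≤ crossCeilingConst δ := by
  unfold crossCeilingConst; positivity

/-- **Cross-term ceiling (ground-state-free).**  For a `δ`-separated configuration (`0 < δ ≤ 1`), every centre `p` and every
radius `ρ ≥ 2`: `½ Σ_{i ∈ B(p,ρ)} Σ_{k ∉ B(p,ρ)} V_LJ(|y_i − y_k|) ≤ C(δ)·ρ²`. -/
theorem crossCeiling_of_sep (y : Fin N → EuclideanSpace ℝ (Fin 3)) {δ : ℝ} (hδ : 0 < δ) (hδ1 : δ ≤ 1)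
    (hsep : ∀ k l : Fin N, k ≠ l → δ ≤ dist (y k) (y l)) (p : EuclideanSpace ℝ (Fin 3)) {ρ : ℝ} (hρ : 2 ≤ ρ) :
    (1 / 2) * ∑ i ∈ (Finset.univ.filter fun i : Fin N => dist (y i) p ≤ ρ),
      ∑ k ∈ Finset.univ.filter (fun k : Fin N => k ∉ (Finset.univ.filter fun i : Fin N => dist (y i) p ≤ ρ)),
        lennardJones (dist (y i) (y k)) ≤ crossCeilingConst δ * ρ ^ 2 := by
  set W := Finset.univ.filter (fun i : Fin N => dist (y i) p ≤ ρ) with hW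
  set T := Finset.univ.filter (fun k : Fin N => k ∉ W) with hT
  have hmW : ∀ i : Fin N, i ∈ W ↔ dist (y i) p ≤ ρ := fun i => by rw [hW]; simp
  have hmT : ∀ k : Fin N, k ∈ T → ρ < dist (y k) p := fun k hk => by
    rw [hT, Finset.mem_filter, hmW] at hk
    exact not_le.1 hk.2
  have hTi : ∀ i ∈ W, ∀ k ∈ T, k ≠ i := fun i hi k hk h => by
    rw [hT, Finset.mem_filter] at hk
    exact hk.2 (h ▸ hi)
  -- split the window into the deep part `|y_i − p| ≤ ρ − 1` (cross sum ≤ 0) and the unit shell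
  set S : ℝ := (2 * 1 / δ + 1) ^ 3 * ((1 / 12) * δ⁻¹ ^ 12) with hS
  have hS0 : 0 ≤ S := by rw [hS]; positivity
  have hsite : ∀ i ∈ W, ∑ k ∈ T, lennardJones (dist (y i) (y k))
      ≤ if dist (y i) p ≤ ρ - 1 then 0 else S := by
    intro i hi
    split_ifs with h
    · exact cross_site_nonpos y p ρ T hmT h
    · exact cross_site_le y hδ hsep T (hTi i hi)
  have hsum := Finset.sum_le_sum hsite
  have hind : ∑ i ∈ W, (if dist (y i) p ≤ ρ - 1 then (0 : ℝ) else S)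
      = ((W.filter fun i => ¬ dist (y i) p ≤ ρ - 1).card : ℝ) * S := by
    rw [← Finset.sum_filter_add_sum_filter_not W (fun i : Fin N => dist (y i) p ≤ ρ - 1)]
    have h1 : ∑ i ∈ W.filter (fun i => dist (y i) p ≤ ρ - 1), (if dist (y i) p ≤ ρ - 1 then (0 : ℝ) else S) = 0 :=
      Finset.sum_eq_zero fun i hi => by rw [if_pos (Finset.mem_filter.1 hi).2]
    have h2 : ∑ i ∈ W.filter (fun i => ¬ dist (y i) p ≤ ρ - 1), (if dist (y i) p ≤ ρ - 1 then (0 : ℝ) else S)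
        = ∑ i ∈ W.filter (fun i => ¬ dist (y i) p ≤ ρ - 1), S :=
      Finset.sum_congr rfl fun i hi => by rw [if_neg (Finset.mem_filter.1 hi).2]
    rw [h1, h2, Finset.sum_const, nsmul_eq_mul, zero_add]
  have hshell : ((W.filter fun i => ¬ dist (y i) p ≤ ρ - 1).card : ℝ) ≤ 48 * δ⁻¹ ^ 3 * (ρ + 1) ^ 2 := by
    have hsub : W.filter (fun i => ¬ dist (y i) p ≤ ρ - 1)
        ⊆ Finset.univ.filter (fun i : Fin N => ρ - ((0 : ℕ) : ℝ) - 1 < dist (y i) p ∧ dist (y i) p ≤ ρ - ((0 : ℕ) : ℝ)) := by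
      intro i hi
      rw [Finset.mem_filter] at hi
      have hiW := (hmW i).1 hi.1
      simp only [Finset.mem_filter, Finset.mem_univ, true_and, Nat.cast_zero, sub_zero]
      exact ⟨not_le.1 hi.2, hiW⟩
    have hL := layer_card y hδ hδ1 hsep p (ρ := ρ) (m := 0) (by simp only [Nat.cast_zero, sub_zero]; linarith)
    exact le_trans (by exact_mod_cast Finset.card_le_card hsub) hL
  have h48 : 48 * (ρ + 1) ^ 2 ≤ 108 * ρ ^ 2 := by nlinarith
  have hδ3 : 0 ≤ δ⁻¹ ^ 3 := by positivity
  have hmain : ∑ i ∈ W, ∑ k ∈ T, lennardJones (dist (y i) (y k)) ≤ 108 * δ⁻¹ ^ 3 * ρ ^ 2 * S := by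
    calc ∑ i ∈ W, ∑ k ∈ T, lennardJones (dist (y i) (y k))
        ≤ ((W.filter fun i => ¬ dist (y i) p ≤ ρ - 1).card : ℝ) * S := by rw [← hind]; exact hsum
      _ ≤ (48 * δ⁻¹ ^ 3 * (ρ + 1) ^ 2) * S := mul_le_mul_of_nonneg_right hshell hS0
      _ = (δ⁻¹ ^ 3 * S) * (48 * (ρ + 1) ^ 2) := by ring
      _ ≤ (δ⁻¹ ^ 3 * S) * (108 * ρ ^ 2) := mul_le_mul_of_nonneg_left h48 (mul_nonneg hδ3 hS0)
      _ = 108 * δ⁻¹ ^ 3 * ρ ^ 2 * S := by ring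
  have hconst : (1 / 2) * (108 * δ⁻¹ ^ 3 * ρ ^ 2 * S) = crossCeilingConst δ * ρ ^ 2 := by
    rw [hS, crossCeilingConst]; ring
  have : Literature.MathematicalPhysics.StatisticalMechanics.lennardJones = lennardJones := rfl
  linarith

/-! ## §4 Ground states: the ceiling, and the two-sided cross bound -/

/-- **Cross-term ceiling for ground states** (`ρ ≥ 2`): `∃ C₃ ≥ 0, ∀ ρ ≥ 2, ∀ N y GS, ∀ p, ½ Σ_{i∈B(p,ρ)} Σ_{k∉B(p,ρ)} V_LJ ≤ C₃ρ²`. -/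
theorem crossCeiling_two : ∃ C₃ : ℝ, 0 ≤ C₃ ∧ ∀ ρ : ℝ, 2 ≤ ρ → ∀ (N : ℕ) (y : Fin N → EuclideanSpace ℝ (Fin 3)),
    IsGroundState lennardJones y → ∀ p : EuclideanSpace ℝ (Fin 3),
      (1 / 2) * ∑ i ∈ (Finset.univ.filter fun i : Fin N => dist (y i) p ≤ ρ),
        ∑ k ∈ Finset.univ.filter (fun k : Fin N => k ∉ (Finset.univ.filter fun i : Fin N => dist (y i) p ≤ ρ)),
          lennardJones (dist (y i) (y k)) ≤ C₃ * ρ ^ 2 := by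
  obtain ⟨δ₀, hδ₀, hsep₀⟩ := LennardJonesMinimalDistance_holds
  set δ : ℝ := min δ₀ 1 with hδdef
  have hδ : 0 < δ := lt_min hδ₀ one_pos
  have hδ1 : δ ≤ 1 := min_le_right _ _
  have hδle : δ ≤ δ₀ := min_le_left _ _
  refine ⟨crossCeilingConst δ, crossCeilingConst_nonneg hδ, ?_⟩
  intro ρ hρ N y hy p
  have hsep : ∀ k l : Fin N, k ≠ l → δ ≤ dist (y k) (y l) := fun k l hkl => hδle.trans (hsep₀ N y hy k l hkl)
  exact crossCeiling_of_sep y hδ hδ1 hsep p hρ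

/-- **Cross-term ceiling for ground states** in the `ρ ≥ 9` normalisation of the floor. -/
theorem crossCeiling : ∃ C₃ : ℝ, ∀ ρ : ℝ, 9 ≤ ρ → ∀ (N : ℕ) (y : Fin N → EuclideanSpace ℝ (Fin 3)),
    IsGroundState lennardJones y → ∀ p : EuclideanSpace ℝ (Fin 3),
      (1 / 2) * ∑ i ∈ (Finset.univ.filter fun i : Fin N => dist (y i) p ≤ ρ),
        ∑ k ∈ Finset.univ.filter (fun k : Fin N => k ∉ (Finset.univ.filter fun i : Fin N => dist (y i) p ≤ ρ)),
          lennardJones (dist (y i) (y k)) ≤ C₃ * ρ ^ 2 := by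
  obtain ⟨C₃, -, h⟩ := crossCeiling_two
  exact ⟨C₃, fun ρ hρ N y hy p => h ρ (by linarith) N y hy p⟩

/-- **Two-sided cross bound for ground states**: `∃ C, ∀ ρ ≥ 9, ∀ GS y, ∀ p, |½ Σ_{i∈B(p,ρ)} Σ_{k∉B(p,ρ)} V_LJ| ≤ C·ρ²`
(floor = tree `stub_crossTermFloor`, ceiling = `crossCeiling`). -/
theorem crossTerm_abs_le : ∃ C : ℝ, ∀ ρ : ℝ, 9 ≤ ρ → ∀ (N : ℕ) (y : Fin N → EuclideanSpace ℝ (Fin 3)),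
    IsGroundState lennardJones y → ∀ p : EuclideanSpace ℝ (Fin 3),
      |(1 / 2) * ∑ i ∈ (Finset.univ.filter fun i : Fin N => dist (y i) p ≤ ρ),
        ∑ k ∈ Finset.univ.filter (fun k : Fin N => k ∉ (Finset.univ.filter fun i : Fin N => dist (y i) p ≤ ρ)),
          lennardJones (dist (y i) (y k))| ≤ C * ρ ^ 2 := by
  obtain ⟨C₂, hfloor⟩ := stub_crossTermFloor
  obtain ⟨C₃, hceil⟩ := crossCeiling
  refine ⟨max C₂ C₃, fun ρ hρ N y hy p => ?_⟩
  have h1 := hfloor ρ hρ N y hy p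
  have h2 := hceil ρ hρ N y hy p
  have hρ2 : 0 ≤ ρ ^ 2 := by positivity
  have h3 : C₂ * ρ ^ 2 ≤ max C₂ C₃ * ρ ^ 2 := mul_le_mul_of_nonneg_right (le_max_left _ _) hρ2
  have h4 : C₃ * ρ ^ 2 ≤ max C₂ C₃ * ρ ^ 2 := mul_le_mul_of_nonneg_right (le_max_right _ _) hρ2
  rw [abs_le]
  constructor <;> linarith

/-! ## §5 Window ↔ chunk currency exchange -/

/-- **Window split.**  For every index set `W` and every reference level `e`:
`Σ_{i∈W} (½𝓔ⁱ − e) = (½ Σ_{i∈W} Σ_{k∈W∖{i}} V − #W·e) + ½ Σ_{i∈W} Σ_{k∉W} V`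
(window currency = chunk currency + half cross term). -/
theorem window_split (y : Fin N → EuclideanSpace ℝ (Fin 3)) (W : Finset (Fin N)) (e : ℝ) :
    ∑ i ∈ W, ((1 / 2) * siteEnergy lennardJones y i - e)
      = ((1 / 2) * ∑ i ∈ W, ∑ k ∈ W.erase i, lennardJones (dist (y i) (y k)) - (W.card : ℝ) * e)
        + (1 / 2) * ∑ i ∈ W, ∑ k ∈ Finset.univ.filter (fun k : Fin N => k ∉ W), lennardJones (dist (y i) (y k)) := by
  have h : ∀ i ∈ W, ((1 / 2) * siteEnergy lennardJones y i - e)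
      = (1 / 2) * ∑ k ∈ W.erase i, lennardJones (dist (y i) (y k))
        + (1 / 2) * ∑ k ∈ Finset.univ.filter (fun k : Fin N => k ∉ W), lennardJones (dist (y i) (y k)) - e := by
    intro i hi
    rw [siteEnergy_split y W hi]
    ring
  rw [Finset.sum_congr rfl h, Finset.sum_sub_distrib, Finset.sum_add_distrib, Finset.sum_const, nsmul_eq_mul,
    ← Finset.mul_sum, ← Finset.mul_sum]
  ring

/-- **Currency exchange for ground states.**  `∃ C, ∀ ρ ≥ 9, ∀ GS y, ∀ p, ∀ e`: the window excess `Σ_{B(p,ρ)}(½𝓔ⁱ − e)` and the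
chunk excess `½ Σ_{i∈B} Σ_{k∈B∖i} V − #B·e` differ by at most `C·ρ²` (both directions). -/
theorem window_chunk_exchange : ∃ C : ℝ, ∀ ρ : ℝ, 9 ≤ ρ → ∀ (N : ℕ) (y : Fin N → EuclideanSpace ℝ (Fin 3)),
    IsGroundState lennardJones y → ∀ (p : EuclideanSpace ℝ (Fin 3)) (e : ℝ),
      |∑ i ∈ (Finset.univ.filter fun i : Fin N => dist (y i) p ≤ ρ), ((1 / 2) * siteEnergy lennardJones y i - e)
        - ((1 / 2) * ∑ i ∈ (Finset.univ.filter fun i : Fin N => dist (y i) p ≤ ρ),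
            ∑ k ∈ (Finset.univ.filter fun i : Fin N => dist (y i) p ≤ ρ).erase i, lennardJones (dist (y i) (y k))
          - ((Finset.univ.filter fun i : Fin N => dist (y i) p ≤ ρ).card : ℝ) * e)| ≤ C * ρ ^ 2 := by
  obtain ⟨C, hC⟩ := crossTerm_abs_le
  refine ⟨C, fun ρ hρ N y hy p e => ?_⟩
  rw [window_split y _ e]
  have h := hC ρ hρ N y hy p
  convert h using 2
  ring

/-- **Chunk floor ⇒ window floor** and **window floor ⇒ chunk floor**, the two usable directions: for ground states and
`ρ ≥ 9`, a lower bound `L` on either excess gives the lower bound `L − C·ρ²` on the other. -/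
theorem window_ge_of_chunk_ge : ∃ C : ℝ, ∀ ρ : ℝ, 9 ≤ ρ → ∀ (N : ℕ) (y : Fin N → EuclideanSpace ℝ (Fin 3)),
    IsGroundState lennardJones y → ∀ (p : EuclideanSpace ℝ (Fin 3)) (e L : ℝ),
      (L ≤ (1 / 2) * ∑ i ∈ (Finset.univ.filter fun i : Fin N => dist (y i) p ≤ ρ),
            ∑ k ∈ (Finset.univ.filter fun i : Fin N => dist (y i) p ≤ ρ).erase i, lennardJones (dist (y i) (y k))
          - ((Finset.univ.filter fun i : Fin N => dist (y i) p ≤ ρ).card : ℝ) * e →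
        L - C * ρ ^ 2 ≤ ∑ i ∈ (Finset.univ.filter fun i : Fin N => dist (y i) p ≤ ρ), ((1 / 2) * siteEnergy lennardJones y i - e))
      ∧
      (L ≤ ∑ i ∈ (Finset.univ.filter fun i : Fin N => dist (y i) p ≤ ρ), ((1 / 2) * siteEnergy lennardJones y i - e) →
        L - C * ρ ^ 2 ≤ (1 / 2) * ∑ i ∈ (Finset.univ.filter fun i : Fin N => dist (y i) p ≤ ρ),
            ∑ k ∈ (Finset.univ.filter fun i : Fin N => dist (y i) p ≤ ρ).erase i, lennardJones (dist (y i) (y k))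
          - ((Finset.univ.filter fun i : Fin N => dist (y i) p ≤ ρ).card : ℝ) * e) := by
  obtain ⟨C, hC⟩ := window_chunk_exchange
  refine ⟨C, fun ρ hρ N y hy p e L => ?_⟩
  have h := abs_le.1 (hC ρ hρ N y hy p e)
  constructor
  · intro hL; linarith [h.1]
  · intro hL; linarith [h.2]

/-- **Order-0 floor in window currency** (a by-product): for ground states and `ρ ≥ 9`,
`Σ_{B(p,ρ)}(½𝓔ⁱ − e⋆) ≥ −C·ρ²` with `e⋆ = ⨅_Q e(Q)` (tree `card_mul_iInf_le_half_sum` + the floor direction of the exchange). -/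
theorem window_floor_eStar : ∃ C : ℝ, ∀ ρ : ℝ, 9 ≤ ρ → ∀ (N : ℕ) (y : Fin N → EuclideanSpace ℝ (Fin 3)),
    IsGroundState lennardJones y → ∀ p : EuclideanSpace ℝ (Fin 3),
      -(C * ρ ^ 2) ≤ ∑ i ∈ (Finset.univ.filter fun i : Fin N => dist (y i) p ≤ ρ),
        ((1 / 2) * siteEnergy lennardJones y i - ⨅ Q : PeriodicConfiguration 3, Q.energyPerParticle lennardJones) := by
  obtain ⟨C, hC⟩ := window_ge_of_chunk_ge
  refine ⟨C, fun ρ hρ N y hy p => ?_⟩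
  have h0 := card_mul_iInf_le_half_sum hy.1 (Finset.univ.filter fun i : Fin N => dist (y i) p ≤ ρ)
  have h := (hC ρ hρ N y hy p (⨅ Q : PeriodicConfiguration 3, Q.energyPerParticle lennardJones) 0).1 (by linarith)
  linarith

end Summit.AtomisticToContinuum.Crystallization.Theorems.ContactSaturationLadderCrossCeiling

end
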